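import Literature.MathematicalPhysics.StatisticalMechanics.StickyDiscFluctuations
import Literature.Geometry.DiscreteGeometry.HarborthContactNumberProof
import Literature.Geometry.DiscreteGeometry.HeitmannRadinSpiral
import Mathlib.LinearAlgebra.Determinant
import HarnessLib

/-!
# De Luca–Friesecke 2017: classification of the particle numbers with a unique Heitmann–Radin
# (sticky disc) minimizer

Topic `Literature/MathematicalPhysics/StatisticalMechanics`; cross-ladder literature-typing layer
(D-0088 (4)), cell `crystal3d-full`, seat `littype-FC1-2` (gen 5).  Fourth file of the two-dimensional
origin of row (4)'s topic (`StickyDiscWulffShape.lean`, `StickyDiscFluctuations.lean`,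
`TriangularLatticeEdgeIsoperimetry.lean`): the complete answer to the microscopic uniqueness question
whose hexagonal case is Schmidt's Proposition 2.7 (`Schmidt2013_uniqueGroundState`) and whose
degenerate side is the `N^{3/4}` law.

## Source, as printed

L. De Luca, G. Friesecke, *Classification of particle numbers with unique Heitmann–Radin minimizer*,
J. Stat. Phys. **167** (2017) 1586–1592 = arXiv:1701.07231 [LucaFriesecke2017] — read on the held arXiv
text `paper:arxiv-1701.07231` (`pNNNN` = chunk of the held text).

* Abstract (p0002): "minimizers of the Heitmann-Radin energy are unique if and only if the particle
  number `N` belongs to an infinite sequence whose first thirty-five elements are 1, 2, 3, 4, 5, 7, 8,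
  10, 12, 14, 16, 19, 21, 24, 27, 30, 33, 37, 40, 44, 48, 52, 56, 61, 65, 70, 75, 80, 85, 91, 96, 102,
  108, 114, 120".
* §1 (p0003): (1.2) `𝓔_HR(X) := ½ Σ_{1≤i<j≤N} V_HR(|xᵢ − xⱼ|)`, (1.3) `V_HR = +∞ / −1 / 0` for
  `r < 1 / r = 1 / r > 1`; "[HR] … the configurations `X` minimizing `𝓔_HR` are, up to rotation and
  translation, subsets of the triangular lattice `𝓛 = {i e + j f}`, `e = (1,0)`, `f = (½, √3/2)`".
  **Theorem 1.1.** "Let `N ∈ ℕ`. The minimizers of `𝓔_HR` among `N`-particle configurations are unique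
  up to translation and rotation if and only if either (a) `N = 3s² + 3s + 1` for some `s ∈ ℕ ∪ {0}`, or
  (b) `N = 3s² + 3s + 1 + (s+1)k + s` for some `s ∈ ℕ ∪ {0}` and some `k ∈ {0,1,2,3,4}`."
* §2 (p0005): configurations are `X ⊂ ℝ²` with `#X = N`; the non-uniqueness half exhibits, for `N` not
  of the form (a)/(b), a second minimizer which "is not a rotated translate of the canonical one".

## Rendering

* A minimizer of `𝓔_HR` among `N`-particle configurations is a maximal disc configuration
  `IsMaximalDiscConfig x`, `x : Fin N → ℝ²` (`UnitDiscContactNumber.lean`;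
  `AuYeungFrieseckeSchmidt2012.isGroundState_stickyPotential_iff`); its particle SET is `Set.range x`
  (the hard core makes `x` injective).
* "unique up to translation and rotation": any two minimizing configurations have point sets related by
  `p ↦ R p + a` with `R` a rotation (linear isometry of determinant `1`, as in
  `AuYeungFrieseckeSchmidt2012.HasCrystallizedGroundStates`) and `a ∈ ℝ²` — `IsUniqueUpToRigidMotion N`.
* `N ∈ ℕ = {1, 2, …}` (the source writes `s ∈ ℕ ∪ {0}`): the equivalence is typed for `N ≥ 1`
  (for `N = 0` the empty configuration is trivially unique while `0` is not of the form (a)/(b)).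

## Contents (namespace `Literature.MathematicalPhysics.StatisticalMechanics.LucaFriesecke2017`)

`IsUniqueUpToRigidMotion N`, `IsUniqueParticleNumber N` ((a) ∨ (b)); NAMED FACT
`LucaFriesecke2017_uniqueness` (Theorem 1.1) — **DISCHARGED**: `LucaFriesecke2017_uniqueness_holds` in
`StickyDiscUniquenessClassification.lean` (the "only if" half from the explicit non-congruent pairs of
`StickyDiscNonUniqueGroundStates.lean` and the clipped-hexagon pairs there); PROVED `isUniqueParticleNumber_seven`,
`not_isUniqueParticleNumber_six` (the list starts `1, 2, 3, 4, 5, 7, …`), and the corollary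
`hexagonal_unique` (case (a), `N = 3s² + 3s + 1`, from the fact); `isMaximalDiscConfig_hexagon` (the
labelled regular hexagon `H_k` IS a ground state, by the tree's Harborth bound) and
`schmidt2013_uniqueGroundState_of` (the fact implies `Schmidt2013_uniqueGroundState`, with `k₀ = 0`).
Gen 7: `isUniqueUpToRigidMotion_hexagonal` — **Theorem 1.1 (a), "if" direction, PROVED** unconditionally
from the tree's `Schmidt2013.exists_rotation_range_eq_hexagon` (Proposition 2.7 is now a theorem,
`Schmidt2013_uniqueGroundState_holds`); `exists_rotation_range_eq_of_frame` (transfer of a frame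
description of maximal centre sets in `ℂ` to labelled ground states `Fin N → ℝ²`),
`exists_rotation_range_eq_config`, `isUniqueUpToRigidMotion_of_typeB` — **Theorem 1.1 (b), "if"
direction, PROVED** (`N = 3s² + 3s + 1 + (s+1)k + s`, `k ≤ 4`, from `Harborth.eq_image_config_of_maximal`,
`HeitmannRadinSpiral.lean`: De Luca–Friesecke's induction on `s`), hence the whole "if" direction
`isUniqueUpToRigidMotion_of_isUniqueParticleNumber` / `LucaFriesecke2017_uniqueness_if`; and
`isMaximalDiscConfig_config` (Harborth's labelled spiral configuration `config r a` IS a ground state — the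
canonical minimizers exist).

WHAT IS NOT HERE: the energy decomposition `𝓔_HR = −3N + P + μ + 3χ` of [DLF] (bond graph, defect
measure, Euler characteristic) and Lemma 2.1 as printed; the "only if" direction of Theorem 1.1 (two
non-congruent minimizers for every other `N`) — proved downstream in `StickyDiscNonUniqueGroundStates.lean` /
`StickyDiscUniquenessClassification.lean` by contact-graph degree statistics instead.
-/

noncomputable section

open Set Function

namespace Literature.MathematicalPhysics.StatisticalMechanics.LucaFriesecke2017

open Literature.Geometry.DiscreteGeometry (IsMaximalDiscConfig)
open Theil2006 (Plane)

/-- **"The minimizers of `𝓔_HR` among `N`-particle configurations are unique up to translation and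
rotation"**: the particle sets of any two minimizing (= maximal-contact) configurations of `N` sticky
discs differ by a rotation followed by a translation. [cite: LucaFriesecke2017, Theorem 1.1 (p0003); §2 (p0005)] -/
def IsUniqueUpToRigidMotion (N : ℕ) : Prop :=
  ∀ x y : Fin N → Plane, IsMaximalDiscConfig x → IsMaximalDiscConfig y →
    ∃ (R : Plane ≃ₗᵢ[ℝ] Plane) (a : Plane),
      LinearMap.det (R.toLinearEquiv : Plane →ₗ[ℝ] Plane) = 1 ∧
        Set.range y = (fun p => R p + a) '' Set.range x

/-- **The particle numbers (a) `N = 3s² + 3s + 1` and (b) `N = 3s² + 3s + 1 + (s+1)k + s`,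
`s ≥ 0`, `k ∈ {0,…,4}`** (the sequence `1, 2, 3, 4, 5, 7, 8, 10, 12, 14, 16, 19, 21, …`).
[cite: LucaFriesecke2017, Theorem 1.1 (a)–(b) (p0003)] -/
def IsUniqueParticleNumber (N : ℕ) : Prop :=
  (∃ s : ℕ, N = 3 * s ^ 2 + 3 * s + 1) ∨
    ∃ s k : ℕ, k ≤ 4 ∧ N = 3 * s ^ 2 + 3 * s + 1 + (s + 1) * k + s

/-- **De Luca–Friesecke 2017, Theorem 1.1 (classification of particle numbers with unique
Heitmann–Radin minimizer), NAMED FACT.**  For `N ≥ 1`, the minimizers of the sticky disc energy among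
`N`-particle configurations in the plane are unique up to translation and rotation if and only if
`N = 3s² + 3s + 1` or `N = 3s² + 3s + 1 + (s+1)k + s` for some `s ≥ 0`, `k ∈ {0,1,2,3,4}`.
[cite: LucaFriesecke2017, Theorem 1.1 (p0003)] -/
def LucaFriesecke2017_uniqueness : Prop :=
  ∀ N : ℕ, 1 ≤ N → (IsUniqueUpToRigidMotion N ↔ IsUniqueParticleNumber N)

/-- `7 = 3·1² + 3·1 + 1` is a uniqueness number (the hexagon `H₁`). [cite: LucaFriesecke2017, Abstract (p0002)] -/
theorem isUniqueParticleNumber_seven : IsUniqueParticleNumber 7 :=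
  Or.inl ⟨1, by norm_num⟩

/-- `6` is NOT a uniqueness number (the list starts `1, 2, 3, 4, 5, 7`).
[cite: LucaFriesecke2017, Abstract (p0002)] -/
theorem not_isUniqueParticleNumber_six : ¬ IsUniqueParticleNumber 6 := by
  rintro (⟨s, hs⟩ | ⟨s, k, hk, hs⟩)
  · rcases Nat.lt_or_ge s 2 with h | h
    · interval_cases s <;> omega
    · nlinarith
  · rcases Nat.lt_or_ge s 2 with h | h
    · interval_cases s <;> interval_cases k <;> omega
    · nlinarith

/-- **Corollary (case (a), PROVED from the fact): for `N = 3s² + 3s + 1` the sticky-disc ground state is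
unique up to rotation and translation** — Schmidt's Proposition 2.7 (`Schmidt2013_uniqueGroundState`
identifies it as the regular hexagon). [cite: LucaFriesecke2017, Theorem 1.1 (a) (p0003)] -/
theorem hexagonal_unique (h : LucaFriesecke2017_uniqueness) (s : ℕ) :
    IsUniqueUpToRigidMotion (3 * s ^ 2 + 3 * s + 1) :=
  (h _ (by omega)).2 (Or.inl ⟨s, rfl⟩)

/-! ## The hexagonal case recovers Schmidt's Proposition 2.7 (PROVED from the fact) -/

open Literature.Geometry.DiscreteGeometry (contactPairCount harborthNumber harborthNumber_hexagonal
  contactPairCount_le_harborthNumber two_mul_contactPairCount_triPoint pairwise_one_le_dist_triPoint)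
open Literature.Geometry.DiscreteGeometry.HarborthSpiral (hexagon count_hexagon adjCount)
open Theil2006 (triPoint)

/-- **The regular hexagon `H_k = 𝓛 ∩ conv(B₁^{(k)},…,B₆^{(k)})`, labelled, is a ground state** of
`N = 3k(k+1) + 1` sticky discs: it is hard and has `9k² + 3k = [3N − √(12N − 3)]` contact pairs, the
maximum by Harborth's theorem (tree: `contactPairCount_le_harborthNumber`). (Heitmann–Radin (2);
Schmidt's Proposition 2.5 for the complete hexagon.) [cite: Schmidt2013, Proposition 2.5 and Proposition 2.7 (p0007–p0008)] -/
theorem isMaximalDiscConfig_hexagon (k : ℕ) :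
    IsMaximalDiscConfig (fun i : Fin (3 * k * (k + 1) + 1) =>
      triPoint (((hexagon k).equivFinOfCardEq (Schmidt2013.card_hexagon k)).symm i : ℤ × ℤ)) := by
  classical
  set e := (hexagon k).equivFinOfCardEq (Schmidt2013.card_hexagon k) with he
  let c : Fin (3 * k * (k + 1) + 1) → ℤ × ℤ := fun i => (e.symm i : ℤ × ℤ)
  have hc : Function.Injective c := fun i j h => e.symm.injective (Subtype.val_injective h)
  have himage : Finset.univ.image c = hexagon k := by
    ext q
    simp only [Finset.mem_image, Finset.mem_univ, true_and, c]
    constructor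
    · rintro ⟨i, rfl⟩
      exact (e.symm i).2
    · intro hq
      exact ⟨e ⟨q, hq⟩, by simp⟩
  refine ⟨pairwise_one_le_dist_triPoint hc, fun y hy => ?_⟩
  -- contact count of the hexagon: `9k² + 3k = harborthNumber N`
  have h2 := two_mul_contactPairCount_triPoint c hc
  rw [himage] at h2
  have hadj := (count_hexagon k).2
  have hcount : ((contactPairCount fun i => triPoint (c i) : ℕ) : ℤ) = 9 * (k : ℤ) ^ 2 + 3 * k := by
    have : (2 : ℤ) * contactPairCount (fun i => triPoint (c i)) = 18 * (k : ℤ) ^ 2 + 6 * k := by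
      rw [← hadj]; exact_mod_cast h2
    linarith
  have hN : 3 * k * (k + 1) + 1 = 3 * k ^ 2 + 3 * k + 1 := by ring
  have hH : harborthNumber (3 * k * (k + 1) + 1) = 9 * (k : ℤ) ^ 2 + 3 * k := by
    rw [hN]; exact_mod_cast harborthNumber_hexagonal k
  have hle := contactPairCount_le_harborthNumber y hy
  rw [hH, ← hcount] at hle
  exact_mod_cast hle

/-- **Schmidt 2013, Proposition 2.7 follows from De Luca–Friesecke's Theorem 1.1 (a)** (with threshold
`k₀ = 0`): for `N = 3k(k+1)+1` every ground state is a rigid motion of the regular hexagon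
`𝓛 ∩ conv(B₁^{(k)},…,B₆^{(k)})` — apply uniqueness to the pair (given ground state, labelled hexagon).
[cite: LucaFriesecke2017, Theorem 1.1 (a) (p0003)] [cite: Schmidt2013, Proposition 2.7 (p0008)] -/
theorem schmidt2013_uniqueGroundState_of (h : LucaFriesecke2017_uniqueness) :
    Schmidt2013.Schmidt2013_uniqueGroundState := by
  classical
  refine ⟨0, fun k _ x hx => ?_⟩
  have hNform : IsUniqueParticleNumber (3 * k * (k + 1) + 1) := Or.inl ⟨k, by ring⟩
  have huniq := (h (3 * k * (k + 1) + 1) (by omega)).2 hNform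
  obtain ⟨R, a, -, hrange⟩ := huniq x _ hx (isMaximalDiscConfig_hexagon k)
  refine ⟨R, a, ?_⟩
  have h1 : Set.range (fun i => R (x i) + a) = (fun p => R p + a) '' Set.range x := by
    rw [← Set.range_comp]; rfl
  rw [h1, ← hrange]
  ext p
  simp only [Set.mem_range, Set.mem_image, Finset.mem_coe]
  constructor
  · rintro ⟨i, rfl⟩
    exact ⟨_, (((hexagon k).equivFinOfCardEq (Schmidt2013.card_hexagon k)).symm i).2, rfl⟩
  · rintro ⟨q, hq, rfl⟩
    exact ⟨(hexagon k).equivFinOfCardEq (Schmidt2013.card_hexagon k) ⟨q, hq⟩, by simp⟩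

/-! ## Theorem 1.1 (a), the "if" direction, PROVED: hexagonal numbers are uniqueness numbers

With Schmidt's Proposition 2.7 now a theorem of the tree (`Schmidt2013.exists_rotation_range_eq_hexagon`,
`Schmidt2013_uniqueGroundState_holds`, via `HeitmannRadinHexagon.lean`), case (a) of Theorem 1.1 in the
direction "`N = 3s² + 3s + 1` ⇒ the minimizer is unique up to translation and rotation" no longer needs
the named fact: two ground states are both carried onto `𝓛 ∩ conv(B₁^{(s)},…,B₆^{(s)})` by rotations
followed by translations, hence onto each other. -/

open Schmidt2013 (exists_rotation_range_eq_hexagon)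

/-- The inverse of a linear isometry of determinant `1` has determinant `1`. [folklore] -/
private theorem det_symm_eq_one {R : Plane ≃ₗᵢ[ℝ] Plane}
    (h : LinearMap.det (R.toLinearEquiv : Plane →ₗ[ℝ] Plane) = 1) :
    LinearMap.det (R.symm.toLinearEquiv : Plane →ₗ[ℝ] Plane) = 1 := by
  have hcomp : (R.symm.toLinearEquiv : Plane →ₗ[ℝ] Plane) ∘ₗ (R.toLinearEquiv : Plane →ₗ[ℝ] Plane) =
      LinearMap.id := by
    apply LinearMap.ext
    intro z
    exact R.symm_apply_apply z
  have hdet := congrArg LinearMap.det hcomp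
  rw [LinearMap.det_comp, h, mul_one, LinearMap.det_id] at hdet
  exact hdet

/-- **De Luca–Friesecke 2017, Theorem 1.1 (a), "if" direction, PROVED: for `N = 3s² + 3s + 1` the
minimizers of the Heitmann–Radin energy among `N`-particle configurations are unique up to translation
and rotation.**  Both ground states are rotated translates of the lattice hexagon
`𝓛 ∩ conv(B₁^{(s)},…,B₆^{(s)})` (`Schmidt2013.exists_rotation_range_eq_hexagon`), so one is a rotated
translate of the other (rotation `R₂⁻¹ R₁`, translation `R₂⁻¹(a₁ − a₂)`).  Supersedes the conditional
`hexagonal_unique`. [cite: LucaFriesecke2017, Theorem 1.1 (a) (p0003)]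
[cite: Schmidt2013, Proposition 2.7 (p0008)] -/
theorem isUniqueUpToRigidMotion_hexagonal (s : ℕ) : IsUniqueUpToRigidMotion (3 * s ^ 2 + 3 * s + 1) := by
  intro x y hx hy
  have hN : 3 * s ^ 2 + 3 * s + 1 = 3 * s * (s + 1) + 1 := by ring
  obtain ⟨R₁, a₁, hd₁, h₁⟩ := exists_rotation_range_eq_hexagon s hN x hx
  obtain ⟨R₂, a₂, hd₂, h₂⟩ := exists_rotation_range_eq_hexagon s hN y hy
  refine ⟨R₁.trans R₂.symm, R₂.symm (a₁ - a₂), ?_, ?_⟩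
  · have hcomp : ((R₁.trans R₂.symm).toLinearEquiv : Plane →ₗ[ℝ] Plane) =
        (R₂.symm.toLinearEquiv : Plane →ₗ[ℝ] Plane) ∘ₗ (R₁.toLinearEquiv : Plane →ₗ[ℝ] Plane) := by
      apply LinearMap.ext
      intro z
      rfl
    rw [hcomp, LinearMap.det_comp, det_symm_eq_one hd₂, hd₁, mul_one]
  · ext p
    constructor
    · rintro ⟨j, rfl⟩
      have hmem : R₂ (y j) + a₂ ∈ Set.range (fun i => R₁ (x i) + a₁) := by
        rw [h₁, ← h₂]; exact ⟨j, rfl⟩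
      obtain ⟨i, hi⟩ := hmem
      dsimp only at hi
      refine ⟨x i, ⟨i, rfl⟩, ?_⟩
      apply R₂.injective
      change R₂ (R₂.symm (R₁ (x i)) + R₂.symm (a₁ - a₂)) = R₂ (y j)
      rw [map_add, R₂.apply_symm_apply, R₂.apply_symm_apply, add_sub, hi, add_sub_cancel_right]
    · rintro ⟨q, ⟨i, rfl⟩, rfl⟩
      have hmem : R₁ (x i) + a₁ ∈ Set.range (fun j => R₂ (y j) + a₂) := by
        rw [h₂, ← h₁]; exact ⟨i, rfl⟩
      obtain ⟨j, hj⟩ := hmem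
      dsimp only at hj
      refine ⟨j, ?_⟩
      apply R₂.injective
      change R₂ (y j) = R₂ (R₂.symm (R₁ (x i)) + R₂.symm (a₁ - a₂))
      rw [map_add, R₂.apply_symm_apply, R₂.apply_symm_apply, add_sub, ← hj, add_sub_cancel_right]

/-! ## Theorem 1.1 (b), the "if" direction, PROVED: `N = 3s² + 3s + 1 + (s+1)k + s`, `k ≤ 4`

`HeitmannRadinSpiral.lean` (`Harborth.eq_image_config_of_maximal`) proves that every maximal configuration
of `N(s,k) = 3s² + 3s + 1 + (s+1)k + s` unit discs, `k ≤ 4`, is a frame image of Harborth's spiral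
configuration `config (s+1) (k(s+1)+s)` — De Luca–Friesecke's induction on `s` (the boundary-stripped
configuration `X ∖ ∂X` is a minimizer with `N(s−1,k)` particles and determines `X`, their Lemma 2.1).
Transferring labelled configurations `Fin N → ℝ²` to centre sets in `ℂ` exactly as in
`Schmidt2013.exists_rotation_range_eq_hexagon` gives case (b), and with case (a) the whole "if"
direction of Theorem 1.1: `IsUniqueParticleNumber N → IsUniqueUpToRigidMotion N`. -/

open Literature.Geometry.DiscreteGeometry.Harborth (framePt framePt_apply IsHard darts mem_darts
  eq_image_config_of_maximal)
open Literature.Geometry.DiscreteGeometry.HarborthSpiral (config card_config harborthNumber_of_ring)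
open Schmidt2013 (orthonormalBasisOneI_symm_triPoint)

/-- **Transfer.** If every maximal centre set of `N` unit discs in `ℂ` (hard, with `[3N − √(12N−3)]`
contacts) is a frame image `Φ_{t,u}(C)`, `|u| = 1`, of one label set `C`, then every ground state
`x : Fin N → ℝ²` is carried onto `triPoint '' C` by a rotation (a linear isometry of determinant `1`)
followed by a translation.  The plumbing of `Schmidt2013.exists_rotation_range_eq_hexagon` with the
hexagon replaced by `C`: move to `ℂ` by `orthonormalBasisOneI`, count darts, apply the hypothesis, and
rotate back by `z ↦ ū(z − t)`. [cite: HeitmannRadin1980, Theorem (2)(a) p. 284]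
[cite: LucaFriesecke2017, §2 (p0005)] -/
theorem exists_rotation_range_eq_of_frame {N : ℕ} (C : Finset (ℤ × ℤ))
    (hC : ∀ P : Finset ℂ, IsHard P → P.card = N →
      2 * harborthNumber P.card ≤ ((darts P).card : ℤ) → ∃ t u : ℂ, ‖u‖ = 1 ∧ P = C.image (framePt t u))
    (x : Fin N → Plane) (hx : IsMaximalDiscConfig x) :
    ∃ (R : Plane ≃ₗᵢ[ℝ] Plane) (a : Plane),
      LinearMap.det (R.toLinearEquiv : Plane →ₗ[ℝ] Plane) = 1 ∧
        Set.range (fun i => R (x i) + a) = triPoint '' (↑C : Set (ℤ × ℤ)) := by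
  classical
  have hxhard := hx.1
  -- move to `ℂ`
  let e : Plane ≃ₗᵢ[ℝ] ℂ := Complex.orthonormalBasisOneI.repr.symm
  let y : Fin N → ℂ := fun i => e (x i)
  have hdist : ∀ i j, dist (y i) (y j) = dist (x i) (x j) := fun i j => e.dist_map (x i) (x j)
  have hyinj : Function.Injective y := by
    intro i j h
    by_contra hij
    have h1 : 1 ≤ dist (x i) (x j) := hxhard hij
    rw [← hdist, h, dist_self] at h1
    exact absurd h1 (by norm_num)
  let P : Finset ℂ := Finset.univ.image y
  have hmem : ∀ i, y i ∈ P := fun i => Finset.mem_image_of_mem y (Finset.mem_univ i)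
  have hcard : P.card = N := by
    rw [Finset.card_image_of_injective _ hyinj, Finset.card_univ, Fintype.card_fin]
  have hhard : IsHard P := by
    intro p hp q hq hpq
    obtain ⟨i, -, rfl⟩ := Finset.mem_image.1 hp
    obtain ⟨j, -, rfl⟩ := Finset.mem_image.1 hq
    have hij : j ≠ i := fun h => hpq (by rw [h])
    rw [← dist_eq_norm, hdist]
    exact hxhard hij
  -- the centre set carries `2 · contactPairCount x` darts
  set A := Finset.univ.filter fun p : Fin N × Fin N => p.1 < p.2 ∧ dist (x p.1) (x p.2) = 1 with hA
  have hAc : A.card = contactPairCount x := rfl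
  let f : Fin N × Fin N → ℂ × ℂ := fun ij => (y ij.1, y ij.2)
  have hfinj : Function.Injective f := by
    intro a b h
    have h' := Prod.mk.inj h
    exact Prod.ext (hyinj h'.1) (hyinj h'.2)
  have hdisj : Disjoint A (A.image Prod.swap) := by
    rw [Finset.disjoint_left]
    intro p hp hp'
    obtain ⟨q, hq, hqp⟩ := Finset.mem_image.1 hp'
    rw [hA, Finset.mem_filter] at hp hq
    rw [← hqp, Prod.fst_swap, Prod.snd_swap] at hp
    exact lt_asymm hp.2.1 hq.2.1
  have hsub : (A ∪ A.image Prod.swap).image f ⊆ darts P := by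
    intro d hd
    obtain ⟨p, hp, rfl⟩ := Finset.mem_image.1 hd
    have h1 : dist (x p.1) (x p.2) = 1 := by
      rcases Finset.mem_union.1 hp with h | h
      · exact (Finset.mem_filter.1 h).2.2
      · obtain ⟨q, hq, rfl⟩ := Finset.mem_image.1 h
        rw [Prod.fst_swap, Prod.snd_swap, dist_comm]
        exact (Finset.mem_filter.1 hq).2.2
    refine mem_darts.2 ⟨⟨hmem _, hmem _⟩, ?_⟩
    change ‖y p.2 - y p.1‖ = 1
    rw [← dist_eq_norm, hdist, dist_comm, h1]
  have h2c : 2 * contactPairCount x ≤ (darts P).card := by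
    calc 2 * contactPairCount x = (A ∪ A.image Prod.swap).card := by
          rw [Finset.card_union_of_disjoint hdisj,
            Finset.card_image_of_injective _ Prod.swap_injective, hAc]
          ring
      _ = ((A ∪ A.image Prod.swap).image f).card := (Finset.card_image_of_injective _ hfinj).symm
      _ ≤ (darts P).card := Finset.card_le_card hsub
  -- maximality
  have hge : harborthNumber N ≤ contactPairCount x := hx.harborthNumber_le_contactPairCount
  have hmax : 2 * harborthNumber P.card ≤ ((darts P).card : ℤ) := by
    rw [hcard]
    have : ((2 * contactPairCount x : ℕ) : ℤ) ≤ (darts P).card := by exact_mod_cast h2c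
    push_cast at this
    linarith
  -- the centre set is `Φ_{t,u}(C)`
  obtain ⟨t, u, hu, hPeq⟩ := hC P hhard hcard hmax
  have hu0 : u ≠ 0 := fun h => by rw [h, norm_zero] at hu; exact zero_ne_one hu
  have huinv : ‖u⁻¹‖ = 1 := by rw [norm_inv, hu, inv_one]
  -- the rigid motion `z ↦ ū (z - t)`, conjugated by `e`
  let uc : Circle := ⟨u⁻¹, by simp [Submonoid.unitSphere, huinv]⟩
  let R : Plane ≃ₗᵢ[ℝ] Plane := (e.trans (rotation uc)).trans e.symm
  have hR : ∀ z : Plane, R z = e.symm (u⁻¹ * e z) := fun z => rfl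
  have hdet : LinearMap.det (R.toLinearEquiv : Plane →ₗ[ℝ] Plane) = 1 := by
    have hconj : (R.toLinearEquiv : Plane →ₗ[ℝ] Plane) =
        (e.symm.toLinearEquiv : ℂ →ₗ[ℝ] Plane) ∘ₗ
          ((rotation uc).toLinearEquiv : ℂ →ₗ[ℝ] ℂ) ∘ₗ
            (e.symm.toLinearEquiv.symm : Plane →ₗ[ℝ] ℂ) := by
      apply LinearMap.ext
      intro z
      rfl
    rw [hconj, LinearMap.det_conj]
    exact det_rotation uc
  refine ⟨R, e.symm (-(u⁻¹ * t)), hdet, ?_⟩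
  have hmove : ∀ i, R (x i) + e.symm (-(u⁻¹ * t)) = e.symm (u⁻¹ * (y i - t)) := by
    intro i
    rw [hR, ← map_add]
    congr 1
    change u⁻¹ * y i + -(u⁻¹ * t) = u⁻¹ * (y i - t)
    ring
  have hframe : ∀ q : ℤ × ℤ, e.symm (u⁻¹ * (framePt t u q - t)) = triPoint q := by
    intro q
    apply e.injective
    rw [e.apply_symm_apply, framePt_apply, add_sub_cancel_left, ← mul_assoc, inv_mul_cancel₀ hu0,
      one_mul]
    exact (orthonormalBasisOneI_symm_triPoint q).symm
  ext z
  simp only [Set.mem_range, Set.mem_image, Finset.mem_coe]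
  constructor
  · rintro ⟨i, rfl⟩
    have hyi : y i ∈ P := hmem i
    rw [hPeq] at hyi
    obtain ⟨q, hq, hyq⟩ := Finset.mem_image.1 hyi
    exact ⟨q, hq, by rw [hmove, ← hyq, hframe]⟩
  · rintro ⟨q, hq, rfl⟩
    have hqP : framePt t u q ∈ P := by rw [hPeq]; exact Finset.mem_image_of_mem _ hq
    obtain ⟨i, -, hyi⟩ := Finset.mem_image.1 hqP
    exact ⟨i, by rw [hmove, hyi, hframe]⟩

/-- **Ground states with `N = 3s² + 3s + 1 + (s+1)k + s` atoms (`k ≤ 4`) are Harborth spiral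
configurations, up to a rotation and a translation**: `{R xᵢ + a} = triPoint '' config (s+1) (k(s+1)+s)`
for a rotation `R` and a translation `a`. [cite: LucaFriesecke2017, Theorem 1.1 (b) (p0003), §2 (p0005)]
[cite: Harborth1974, p. 15] -/
theorem exists_rotation_range_eq_config (s k : ℕ) (hk : k ≤ 4) {N : ℕ}
    (hN : N = 3 * s ^ 2 + 3 * s + 1 + (s + 1) * k + s) (x : Fin N → Plane) (hx : IsMaximalDiscConfig x) :
    ∃ (R : Plane ≃ₗᵢ[ℝ] Plane) (a : Plane),
      LinearMap.det (R.toLinearEquiv : Plane →ₗ[ℝ] Plane) = 1 ∧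
        Set.range (fun i => R (x i) + a) =
          triPoint '' (↑(config (s + 1) (k * (s + 1) + s)) : Set (ℤ × ℤ)) :=
  exists_rotation_range_eq_of_frame _
    (fun _ hP hc hmax => eq_image_config_of_maximal hP hk (hc.trans hN) hmax) x hx

/-- Two ground states both carried onto one set by rotations followed by translations differ by a
rotation followed by a translation (`R₂⁻¹ R₁`, `R₂⁻¹(a₁ − a₂)`). [cite: LucaFriesecke2017, §2 (p0005)] -/
theorem isUniqueUpToRigidMotion_of_forall_range_eq {N : ℕ} (T : Set Plane)
    (h : ∀ x : Fin N → Plane, IsMaximalDiscConfig x → ∃ (R : Plane ≃ₗᵢ[ℝ] Plane) (a : Plane),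
      LinearMap.det (R.toLinearEquiv : Plane →ₗ[ℝ] Plane) = 1 ∧ Set.range (fun i => R (x i) + a) = T) :
    IsUniqueUpToRigidMotion N := by
  intro x y hx hy
  obtain ⟨R₁, a₁, hd₁, h₁⟩ := h x hx
  obtain ⟨R₂, a₂, hd₂, h₂⟩ := h y hy
  refine ⟨R₁.trans R₂.symm, R₂.symm (a₁ - a₂), ?_, ?_⟩
  · have hcomp : ((R₁.trans R₂.symm).toLinearEquiv : Plane →ₗ[ℝ] Plane) =
        (R₂.symm.toLinearEquiv : Plane →ₗ[ℝ] Plane) ∘ₗ (R₁.toLinearEquiv : Plane →ₗ[ℝ] Plane) := by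
      apply LinearMap.ext
      intro z
      rfl
    rw [hcomp, LinearMap.det_comp, det_symm_eq_one hd₂, hd₁, mul_one]
  · ext p
    constructor
    · rintro ⟨j, rfl⟩
      have hmem : R₂ (y j) + a₂ ∈ Set.range (fun i => R₁ (x i) + a₁) := by
        rw [h₁, ← h₂]; exact ⟨j, rfl⟩
      obtain ⟨i, hi⟩ := hmem
      dsimp only at hi
      refine ⟨x i, ⟨i, rfl⟩, ?_⟩
      apply R₂.injective
      change R₂ (R₂.symm (R₁ (x i)) + R₂.symm (a₁ - a₂)) = R₂ (y j)
      rw [map_add, R₂.apply_symm_apply, R₂.apply_symm_apply, add_sub, hi, add_sub_cancel_right]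
    · rintro ⟨q, ⟨i, rfl⟩, rfl⟩
      have hmem : R₁ (x i) + a₁ ∈ Set.range (fun j => R₂ (y j) + a₂) := by
        rw [h₂, ← h₁]; exact ⟨i, rfl⟩
      obtain ⟨j, hj⟩ := hmem
      dsimp only at hj
      refine ⟨j, ?_⟩
      apply R₂.injective
      change R₂ (y j) = R₂ (R₂.symm (R₁ (x i)) + R₂.symm (a₁ - a₂))
      rw [map_add, R₂.apply_symm_apply, R₂.apply_symm_apply, add_sub, ← hj, add_sub_cancel_right]

/-- **De Luca–Friesecke 2017, Theorem 1.1 (b), "if" direction, PROVED: for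
`N = 3s² + 3s + 1 + (s+1)k + s`, `k ∈ {0,…,4}`, the minimizers of the Heitmann–Radin energy among
`N`-particle configurations are unique up to translation and rotation.**
[cite: LucaFriesecke2017, Theorem 1.1 (b) (p0003), §2 (p0005)] -/
theorem isUniqueUpToRigidMotion_of_typeB (s k : ℕ) (hk : k ≤ 4) :
    IsUniqueUpToRigidMotion (3 * s ^ 2 + 3 * s + 1 + (s + 1) * k + s) :=
  isUniqueUpToRigidMotion_of_forall_range_eq _ fun x hx => exists_rotation_range_eq_config s k hk rfl x hx

/-- **Theorem 1.1, "if" direction, PROVED**: every particle number of the form (a) or (b) has a minimizer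
unique up to translation and rotation. [cite: LucaFriesecke2017, Theorem 1.1 (p0003)] -/
theorem isUniqueUpToRigidMotion_of_isUniqueParticleNumber {N : ℕ} (h : IsUniqueParticleNumber N) :
    IsUniqueUpToRigidMotion N := by
  rcases h with ⟨s, rfl⟩ | ⟨s, k, hk, rfl⟩
  · exact isUniqueUpToRigidMotion_hexagonal s
  · exact isUniqueUpToRigidMotion_of_typeB s k hk

/-- The "if" half of the named fact `LucaFriesecke2017_uniqueness`, as a theorem.
[cite: LucaFriesecke2017, Theorem 1.1 (p0003)] -/
theorem LucaFriesecke2017_uniqueness_if (N : ℕ) (_hN : 1 ≤ N) (h : IsUniqueParticleNumber N) :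
    IsUniqueUpToRigidMotion N :=
  isUniqueUpToRigidMotion_of_isUniqueParticleNumber h

/-- **The canonical minimizers exist: Harborth's labelled spiral configuration `config r a` is a ground
state** of `N = 3r² − 3r + 1 + a` sticky discs (`r ≥ 1`, `a < 6r`): it is hard and has
`9(r−1)² + 3(r−1) + ringContacts r a = [3N − √(12N−3)]` contacts (Harborth's identity (6)), the maximum.
[cite: LucaFriesecke2017, §2 (p0005) (canonical minimizers)] [cite: Harborth1974, (6) p. 15] -/
theorem isMaximalDiscConfig_config {r a N : ℕ} (hr : 1 ≤ r) (ha : a < 6 * r)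
    (hN : (N : ℤ) = 3 * (r : ℤ) ^ 2 - 3 * r + 1 + a) (hcard : (config r a).card = N) :
    IsMaximalDiscConfig (fun i : Fin N => triPoint (((config r a).equivFinOfCardEq hcard).symm i : ℤ × ℤ)) := by
  classical
  set e := (config r a).equivFinOfCardEq hcard with he
  let c : Fin N → ℤ × ℤ := fun i => (e.symm i : ℤ × ℤ)
  have hc : Function.Injective c := fun i j h => e.symm.injective (Subtype.val_injective h)
  have himage : Finset.univ.image c = config r a := by
    ext q
    simp only [Finset.mem_image, Finset.mem_univ, true_and, c]
    constructor
    · rintro ⟨i, rfl⟩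
      exact (e.symm i).2
    · intro hq
      exact ⟨e ⟨q, hq⟩, by simp⟩
  refine ⟨pairwise_one_le_dist_triPoint hc, fun y hy => ?_⟩
  have h2 := two_mul_contactPairCount_triPoint c hc
  rw [himage] at h2
  have hadj := (card_config hr ha.le).2
  have hH := harborthNumber_of_ring hr ha hN
  have hcount : ((contactPairCount fun i => triPoint (c i) : ℕ) : ℤ) = harborthNumber N := by
    have : (2 : ℤ) * contactPairCount (fun i => triPoint (c i)) = adjCount (config r a) := by
      exact_mod_cast h2
    linarith
  have hle := contactPairCount_le_harborthNumber y hy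
  rw [← hcount] at hle
  have hle' : contactPairCount y ≤ contactPairCount fun i => triPoint (c i) := by exact_mod_cast hle
  exact hle'

/-- The labelled configuration `config (s+1) (k(s+1)+s)` has `N(s,k) = 3s² + 3s + 1 + (s+1)k + s` labels.
[cite: Harborth1974, p. 15] -/
theorem card_config_typeB' (s k : ℕ) (hk : k ≤ 4) :
    (config (s + 1) (k * (s + 1) + s)).card = 3 * s ^ 2 + 3 * s + 1 + (s + 1) * k + s :=
  Literature.Geometry.DiscreteGeometry.Harborth.card_config_typeB s k (by omega)

/-- **The canonical minimizer of type (b) is a ground state**, `N = 3s² + 3s + 1 + (s+1)k + s`, `k ≤ 4`;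
with `exists_rotation_range_eq_config`, every ground state with this `N` is a rigid motion of it.
[cite: LucaFriesecke2017, Theorem 1.1 (b) (p0003), §2 (p0005)] -/
theorem isMaximalDiscConfig_config_typeB (s k : ℕ) (hk : k ≤ 4) :
    IsMaximalDiscConfig (fun i : Fin (3 * s ^ 2 + 3 * s + 1 + (s + 1) * k + s) =>
      triPoint (((config (s + 1) (k * (s + 1) + s)).equivFinOfCardEq
        (card_config_typeB' s k hk)).symm i : ℤ × ℤ)) :=
  isMaximalDiscConfig_config (by omega) (by nlinarith) (by push_cast; ring) _

end Literature.MathematicalPhysics.StatisticalMechanics.LucaFriesecke2017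

end
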